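import Summits.QuantumAdvantage.QuantumAdvantage.Theorems.CubicForrelationNearExactIsExactKtGapRestrict

/-!
# Crux `CubicForrelation.NearExactIsExact` (stmt-QuantumAdvantage-14043) — tools for the Kasami–Tokura gap of cubics, II: the character
  sum of a support (half weights, Parseval, fourth moment, hyperplanes), uniform in `m`

Certificate seat `b2b-cforr-cert` (gen 16).  HONEST FRAMING: elementary Fourier TOOLS (standard axioms, uniform in the number of bits) for the
brick "no cubic Boolean function on `m ≤ 12` bits has weight strictly between `3·2^{m-4}` and `7·2^{m-5}`" (`…KtGapCubic.lean`).  They are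
the general-`m` versions of the inline computations of `to15_weight784_none` / `to15_weight_gap_none` (gen 15, 12 bits).  NOT summit progress.

With `F(z) = Σ_{x∈E} (−1)^{x·z}` for a finite `E ⊆ 𝔽₂^m` and `I(a) = #(E ∩ (E ⊕ a))`:
* `ktg_F_half`: `F(z) = #E − 2·#(E ∩ {⟨x,z⟩ odd})`; `ktg_half_add`: the two halves add up to `#E`;
* `ktg_parseval`: `Σ_z F(z)² = 2^m #E`; `ktg_fourth`: `Σ_z F(z)⁴ = 2^m Σ_a I(a)²`;
* `ktg_no_hyperplane`: if every `I(a) > 0` then `F(z) ≠ ±#E` for `z ≠ 0` (`E` lies in no affine hyperplane);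
* `ktg_sum_two_values`: bookkeeping for `Σ_z φ(g z)` when `g` takes two values off one point.

References: R. O'Donnell, *Analysis of Boolean Functions* (2014) §1.4, §3.3; MacWilliams–Sloane (1977) Ch. 5.  Everything below is proved
from Mathlib and the tree; axioms are the standard three.
-/

set_option linter.dupNamespace false -- D-0017: single-problem summit ⇒ `QuantumAdvantage.QuantumAdvantage` by design

noncomputable section

namespace Summit.QuantumAdvantage.QuantumAdvantage.Theorems.CubicForrelation.NearExactIsExact

open Finset
open Literature.Computability.QuantumComplexity
open Literature.Computability.QuantumComplexity.BuzetChailloux (bxor zeroVec bxor_bxor_cancel_left bxor_zeroVec zeroVec_bxor bxor_comm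
  bxor_self twist_zeroVec_right twist_bxor_right)
open Literature.Computability.QuantumComplexity.DerivativeWalsh (W twist_bxor_left)
open Literature.Computability.QuantumComplexity.Simon (twist_eq_one_or)
open Summit.QuantumAdvantage.QuantumAdvantage.Theorems.SignedCubicForrelationNotPrBPP (knf_isDegLeFun_ip)

/-! ### The character sum of the support: half weights, Parseval, fourth moment, hyperplanes -/

/-- The character sum `F(z) = Σ_{x∈E} (−1)^{x·z}` equals `#E − 2·#(E ∩ {⟨x,z⟩ odd})`. [folklore] -/
theorem ktg_F_half {m : ℕ} (c : (Fin m → Bool) → Bool) (z : Fin m → Bool) :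
    ∑ x ∈ univ.filter (fun x => c x = true), twist x z =
      #(univ.filter fun x => c x = true) -
        2 * (#(univ.filter fun x => c x = true ∧ decide (Odd #(univ.filter fun i => (x i && z i) = true)) = true) : ℝ) := by
  classical
  set S := univ.filter (fun x : Fin m → Bool => c x = true) with hSdef
  set ℓ : (Fin m → Bool) → Bool := fun x => decide (Odd #(univ.filter fun i => (x i && z i) = true)) with hℓdef
  have htw : ∀ x, twist x z = 1 - 2 * (if ℓ x = true then (1 : ℝ) else 0) := by
    intro x
    rw [vg_twist_eq_signOf x z]
    change signOf (ℓ x) = 1 - 2 * (if ℓ x = true then (1 : ℝ) else 0)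
    unfold signOf
    cases ℓ x <;> norm_num
  have e : S.filter (fun x => ℓ x = true) = univ.filter fun x => c x = true ∧ ℓ x = true := by
    ext x; simp only [hSdef, mem_filter, mem_univ, true_and]
  rw [sum_congr rfl fun x _ => htw x, sum_sub_distrib, sum_const, nsmul_eq_mul, mul_one, ← mul_sum, sum_boole, e]

/-- The two half weights add up: `#(E ∩ {⟨x,z⟩ odd}) + #(E ∩ {⟨x,z⟩ even}) = #E`. [folklore] -/
theorem ktg_half_add {m : ℕ} (c : (Fin m → Bool) → Bool) (z : Fin m → Bool) :
    #(univ.filter fun x => c x = true ∧ decide (Odd #(univ.filter fun i => (x i && z i) = true)) = true) +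
      #(univ.filter fun x => c x = true ∧ decide (Odd #(univ.filter fun i => (x i && z i) = true)) = false) =
        #(univ.filter fun x => c x = true) := by
  classical
  set ℓ : (Fin m → Bool) → Bool := fun x => decide (Odd #(univ.filter fun i => (x i && z i) = true)) with hℓdef
  have e1 : (univ.filter fun x => c x = true ∧ ℓ x = true) = (univ.filter fun x : Fin m → Bool => c x = true).filter (fun x => ℓ x = true) := by
    ext x; simp only [mem_filter, mem_univ, true_and]
  have e2 : (univ.filter fun x => c x = true ∧ ℓ x = false) =
      (univ.filter fun x : Fin m → Bool => c x = true).filter (fun x => ¬ ℓ x = true) := by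
    ext x; simp only [mem_filter, mem_univ, true_and, Bool.not_eq_true]
  rw [e1, e2, card_filter_add_card_filter_not]

/-- **Parseval for the support**: `Σ_z F(z)² = 2^m·#E`. [folklore; `fp_parseval_pm`] -/
theorem ktg_parseval {m : ℕ} (S : Finset (Fin m → Bool)) :
    ∑ z, (∑ x ∈ S, twist x z) ^ 2 = (2 : ℝ) ^ m * #S := by
  classical
  set A : (Fin m → Bool) → ℝ := fun x => if x ∈ S then 1 else 0 with hAdef
  have hWA : ∀ z, W A z = ∑ x ∈ S, twist x z := by
    intro z
    unfold W
    have e : ∀ x, A x * twist x z = if x ∈ S then twist x z else 0 := fun x => by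
      simp only [A]; split_ifs <;> simp
    rw [sum_congr rfl fun x _ => e x, ← sum_filter, filter_mem_eq_inter, univ_inter]
  have h := fp_parseval_pm A S (fun x hx => Or.inl (by simp [A, hx])) (fun x hx => by simp [A, hx])
  rw [sum_congr rfl fun z _ => by rw [hWA z]] at h
  exact h

/-- **Fourth moment of the character sum**: `Σ_z F(z)⁴ = 2^m · Σ_a #(E ∩ (E ⊕ a))²`. [folklore; O'Donnell §3.3] -/
theorem ktg_fourth {m : ℕ} (S : Finset (Fin m → Bool)) :
    ∑ z, (∑ x ∈ S, twist x z) ^ 4 = (2 : ℝ) ^ m * ∑ a, (#(S.filter fun x => bxor x a ∈ S) : ℝ) ^ 2 := by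
  classical
  set F : (Fin m → Bool) → ℝ := fun z => ∑ x ∈ S, twist x z with hFdef
  set P2 := S ×ˢ S with hP2
  set J : (Fin m → Bool) → ℕ := fun a => #(P2.filter fun q => bxor q.1 q.2 = a) with hJdef
  have hJI : ∀ a, J a = #(S.filter fun x => bxor x a ∈ S) := by
    intro a
    simp only [J]
    refine card_nbij' (fun q => q.1) (fun x => (x, bxor x a)) (fun q hq => ?_) (fun x hx => ?_) (fun q hq => ?_) (fun x _ => rfl)
    · rw [mem_coe, mem_filter, hP2, mem_product] at hq
      rw [mem_coe, mem_filter]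
      refine ⟨hq.1.1, ?_⟩
      rw [← hq.2, bxor_bxor_cancel_left]; exact hq.1.2
    · rw [mem_coe, mem_filter] at hx
      rw [mem_coe, mem_filter, hP2, mem_product]
      exact ⟨⟨hx.1, hx.2⟩, bxor_bxor_cancel_left _ _⟩
    · rw [mem_coe, mem_filter] at hq
      obtain ⟨-, h⟩ := hq
      show (q.1, bxor q.1 a) = q
      rw [← h, bxor_bxor_cancel_left]
  set Q := (P2 ×ˢ P2).filter (fun q => bxor q.1.1 q.1.2 = bxor q.2.1 q.2.2) with hQdef
  have hQ : (#Q : ℝ) = ∑ a, (J a : ℝ) ^ 2 := by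
    have h := card_eq_sum_card_fiberwise (s := Q) (t := (univ : Finset (Fin m → Bool))) (f := fun q => bxor q.1.1 q.1.2)
      (fun q _ => mem_univ _)
    rw [h]; push_cast
    refine sum_congr rfl fun a _ => ?_
    have e : Q.filter (fun q => bxor q.1.1 q.1.2 = a) = (P2.filter fun q => bxor q.1 q.2 = a) ×ˢ (P2.filter fun q => bxor q.1 q.2 = a) := by
      ext q
      simp only [hQdef, mem_filter, mem_product]
      constructor
      · rintro ⟨⟨hq, heq⟩, ha⟩; exact ⟨⟨hq.1, ha⟩, hq.2, by rw [← heq, ha]⟩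
      · rintro ⟨⟨h1', ha1⟩, h2', ha2⟩; exact ⟨⟨⟨h1', h2'⟩, by rw [ha1, ha2]⟩, ha1⟩
    rw [e, card_product]; push_cast; ring
  have hF2 : ∀ z, F z ^ 2 = ∑ q ∈ P2, twist (bxor q.1 q.2) z := by
    intro z
    rw [sq, hFdef, sum_mul_sum, hP2, sum_product]
    exact sum_congr rfl fun x _ => sum_congr rfl fun y _ => (twist_bxor_left x y z).symm
  have hF4 : ∑ z, F z ^ 4 = 2 ^ m * (#Q : ℝ) := by
    have e1 : ∀ z, F z ^ 4 = ∑ q ∈ P2 ×ˢ P2, twist (bxor (bxor q.1.1 q.1.2) (bxor q.2.1 q.2.2)) z := by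
      intro z
      rw [show F z ^ 4 = F z ^ 2 * F z ^ 2 by ring, hF2 z, sum_mul_sum, Finset.sum_product (s := P2) (t := P2)]
      exact sum_congr rfl fun q _ => sum_congr rfl fun q' _ => (twist_bxor_left _ _ z).symm
    rw [sum_congr rfl fun z _ => e1 z, sum_comm]
    rw [sum_congr rfl fun q _ => Simon.sum_twist (bxor (bxor q.1.1 q.1.2) (bxor q.2.1 q.2.2))]
    rw [← sum_filter, sum_const, nsmul_eq_mul]
    have e2 : (P2 ×ˢ P2).filter (fun q => bxor (bxor q.1.1 q.1.2) (bxor q.2.1 q.2.2) = fun _ => false) = Q := by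
      rw [hQdef]
      refine filter_congr fun q _ => ?_
      constructor
      · intro h
        have := congrArg (bxor (bxor q.1.1 q.1.2)) h
        rw [bxor_bxor_cancel_left] at this
        rw [this]; exact (bxor_zeroVec _).symm
      · intro h; rw [h]; exact bxor_self _
    rw [e2, mul_comm]
  rw [show (∑ z, (∑ x ∈ S, twist x z) ^ 4) = ∑ z, F z ^ 4 from rfl, hF4, hQ]
  congr 1
  exact sum_congr rfl fun a _ => by rw [hJI a]

/-- **No hyperplane contains the support** when every derivative intersection is positive: `F(z) ≠ ±#E` for `z ≠ 0`. [folklore] -/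
theorem ktg_no_hyperplane {m : ℕ} (S : Finset (Fin m → Bool)) (hI : ∀ a, 0 < #(S.filter fun x => bxor x a ∈ S))
    (z : Fin m → Bool) (hz : z ≠ zeroVec) :
    (∑ x ∈ S, twist x z) ≠ #S ∧ (∑ x ∈ S, twist x z) ≠ -#S := by
  classical
  have htw1 : ∀ x z : Fin m → Bool, twist x z ≤ 1 := fun x z => by
    rcases twist_eq_one_or x z with h | h <;> linarith
  have htw1' : ∀ x z : Fin m → Bool, -1 ≤ twist x z := fun x z => by
    rcases twist_eq_one_or x z with h | h <;> linarith
  have hI0_of : ∀ (a : Fin m → Bool) (t : ℝ), (t = 1 ∨ t = -1) → twist a z = -1 → (∀ x ∈ S, twist x z = t) →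
      #(S.filter fun x => bxor x a ∈ S) = 0 := by
    intro a t ht ha hall
    refine card_eq_zero.2 (filter_eq_empty_iff.2 fun x hx hxa => ?_)
    have h1 := hall _ hxa
    rw [twist_bxor_left, hall x hx, ha] at h1
    rcases ht with rfl | rfl <;> norm_num at h1
  obtain ⟨a, ha⟩ := es_exists_twist_neg hz
  rw [twist_comm] at ha
  have hIa : #(S.filter fun x => bxor x a ∈ S) ≠ 0 := (hI a).ne'
  constructor
  · intro hF
    refine hIa (hI0_of a 1 (Or.inl rfl) ha fun x hx => ?_)
    have hsum0 : ∑ y ∈ S, (1 - twist y z) = 0 := by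
      rw [sum_sub_distrib, sum_const, nsmul_eq_mul, mul_one, hF]; ring
    have h := (sum_eq_zero_iff_of_nonneg fun y _ => by linarith [htw1 y z]).1 hsum0 x hx
    linarith
  · intro hF
    refine hIa (hI0_of a (-1) (Or.inr rfl) ha fun x hx => ?_)
    have hsum0 : ∑ y ∈ S, (1 + twist y z) = 0 := by
      rw [sum_add_distrib, sum_const, nsmul_eq_mul, mul_one, hF]; ring
    have h := (sum_eq_zero_iff_of_nonneg fun y _ => by linarith [htw1' y z]).1 hsum0 x hx
    linarith

/-! ### Bookkeeping: sums of a function taking two values off one point -/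

/-- If `g` takes only the values `α ≠ β` off the point `z₀`, then `Σ_z φ(g z) = φ(g z₀) + A·φ(α) + B·φ(β)` with
`A = #{z ≠ z₀ : g z = α}`, `B = #{z ≠ z₀ : g z = β}`, and `A + B + 1 = #ι`. [folklore] -/
theorem ktg_sum_two_values {ι : Type*} [Fintype ι] [DecidableEq ι] (g : ι → ℝ) (z₀ : ι) (α β : ℝ) (hαβ : α ≠ β)
    (h : ∀ z, z ≠ z₀ → g z = α ∨ g z = β) (φ : ℝ → ℝ) :
    ∑ z, φ (g z) = φ (g z₀) + #(univ.filter fun z => z ≠ z₀ ∧ g z = α) * φ α + #(univ.filter fun z => z ≠ z₀ ∧ g z = β) * φ β ∧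
      #(univ.filter fun z => z ≠ z₀ ∧ g z = α) + #(univ.filter fun z => z ≠ z₀ ∧ g z = β) + 1 = Fintype.card ι := by
  classical
  set TA := univ.filter (fun z => z ≠ z₀ ∧ g z = α) with hTA
  set TB := univ.filter (fun z => z ≠ z₀ ∧ g z = β) with hTB
  have hdisj : Disjoint TA TB := by
    rw [hTA, hTB, disjoint_filter]; intro z _ h1 h2; exact hαβ (h1.2.symm.trans h2.2)
  have hdisj0 : Disjoint (TA ∪ TB) {z₀} := disjoint_singleton_right.2 (by simp [hTA, hTB])
  have hcover : (univ : Finset ι) = (TA ∪ TB) ∪ {z₀} := by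
    ext z
    simp only [mem_univ, mem_union, mem_singleton, hTA, hTB, mem_filter, true_and, true_iff]
    by_cases hz : z = z₀
    · exact Or.inr hz
    · rcases h z hz with hg | hg
      · exact Or.inl (Or.inl ⟨hz, hg⟩)
      · exact Or.inl (Or.inr ⟨hz, hg⟩)
  have hA : ∑ z ∈ TA, φ (g z) = #TA * φ α := by
    rw [sum_congr rfl (g := fun _ => φ α) fun z hz => by rw [(mem_filter.1 hz).2.2], sum_const, nsmul_eq_mul]
  have hB : ∑ z ∈ TB, φ (g z) = #TB * φ β := by
    rw [sum_congr rfl (g := fun _ => φ β) fun z hz => by rw [(mem_filter.1 hz).2.2], sum_const, nsmul_eq_mul]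
  constructor
  · rw [hcover, sum_union hdisj0, sum_union hdisj, sum_singleton, hA, hB]
    ring
  · have h := congrArg card hcover
    rw [card_union_of_disjoint hdisj0, card_union_of_disjoint hdisj, card_singleton, card_univ] at h
    omega

end Summit.QuantumAdvantage.QuantumAdvantage.Theorems.CubicForrelation.NearExactIsExact

end
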